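import Summits.CriticalPhenomena.PercolationContinuityZ3.Theorems.PercNearOneGluingNoHeavyQuantSDEC
import HarnessLib

/-!
# QUANT lane R8, heavy node: the `d = 0` row of the GATED two-layer bound is a one-law Markov fact
# (`LawDec.gate_row_zero`), hence the `d = 0` row of `TLBGateConvClosedHeavy`'s conclusion holds for EVERY floor
# `0 < y < 1` and every gate, from the two means and top-affordability alone (`LawDec.gate_lconv_row_zero`)

builds on p205010 (kernel theorem, internal audit signed; external expert review pending)

Support file (`--supports stmt-CriticalPhenomena-4575`), QUANT lane typer seat prim-quant-stmt (gen 34), rung R8 of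
`run/shared/lean/prim/quant/LADDER.md`.  No definitions, no sorries, standard axioms.  Imports only `…QuantSDEC` (`LawDec.gate`,
`LawDec.lconv`, `sum_lconv`, `sum_mul_lconv`), so that it elaborates ahead of the farm backlog on `…QuantTLBClosure`; the two
inequalities below are LITERALLY the `d = 0` instances of `LawDec.TLB (y/(1−y)) (q·T) M (gate ν q)` resp. of the conclusion of
`LawDec.TLBGateConvClosedHeavy` (lead g37, ⧗ p376241), written out.

THE OBSERVATION (typer g34).  The lead's paper theorem PHANTOM-K0-G37 / LEAD-NOTES-G37 N17 (the `k = 0` row of the gated heavy node via the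
one-reflection + mean-tilt certificate D0T, ≈ 1 page of case analysis, orientation rule `t₂ ≤ t₁`, `y ≥ 1/2` used) is a TWO-LINE MARKOV
FACT about ONE law, needing neither a reflection, nor `y ≥ 1/2`, nor the convolution structure.  For a probability law `ν` on `{0..M}` with
mean `T`, a gate `0 < q ≤ 1`, target `t := q·T > 0` and top-affordability `y·M ≤ t` (`u := y/(1−y)`):

  `T = Σ h·ν(h) ≤ t·ν(0 < h < t) + M·ν(h ≥ t) ≤ t·(1 − ν(0)) + (M − t)·ν(h ≥ t)`,

so `(M − t)·ν(h ≥ t) ≥ (T − t) + t·ν(0)`, and with `M − t ≤ t(1−y)/y = t/u` (TA) and `T − t = t(1−q)/q`: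
`q·ν(h ≥ t) ≥ u(1−q) + u·q·ν(0)`, which is `u·(gate ν q)(0) ≤ (gate ν q)(h ≥ t)` — the `d = 0` row.  Applied to `ν = lconv μ₁ μ₂`
(mean `T₁ + T₂` by `sum_mul_lconv`, support `M₁ + M₂`, top-affordability adds up) this is the `d = 0` row of the heavy node's conclusion
for ALL `0 < y < 1` — consistent with `not_tlbGateConvClosed` (whose light-half witness violates the row `d = 2`, not `d = 0`).
The rows `d ≥ 1` are NOT of this kind (a one-law statement from `TLB` of the product + mean + TA is false: typer g34 explore/olg.py,
exact 3-atom witnesses `{1, 2, M}`), and remain the open design (lane STATEMENTS §AL).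

* `LawDec.gate_row_zero` — the one-law fact.
* `LawDec.gate_lconv_row_zero` — the `d = 0` row of the gated convolution, in the binder of `TLBGateConvClosed(Heavy)` minus the two
  `TLB` hypotheses and minus `1/2 ≤ y`.

HONEST STATUS: `TLBGateConvClosedHeavy`, `FarTreeRowHeavy`, `FarTreeRow` OPEN; nothing here is a published result; the RATE class log\* and
the honest sentence of `run/shared/lean/prim/quant/README.md` are unchanged.

[this work]; Markov's inequality [folklore].  The gluing rows served [cite: KozmaNitzan2024, Conjecture 3 (p. 15)]; product measure
[cite: Grimmett1999, §1.3 p. 10].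
-/

noncomputable section

namespace Summit.CriticalPhenomena.PercolationContinuityZ3.Theorems

namespace Quant

open Finset

namespace LawDec

/-- **THE `d = 0` ROW OF THE GATED TWO-LAYER BOUND IS MARKOV.**  For a probability law `ν` on `{0..M}` with mean `T`, a floor
`0 < y < 1`, a gate `0 < q` (`q ≤ 1` is not even needed) with `0 < q·T` and top-affordability `y·M ≤ q·T`:
`y/(1−y) · (gate ν q)(0) ≤ Σ_{h ≤ M, q·T ≤ h} (gate ν q)(h)` — literally the `d = 0` instance of
`LawDec.TLB (y/(1−y)) (q·T) M (gate ν q)` of `…QuantTLBClosure`.  Proof: `T ≤ q·T·(1 − ν 0) + (M − q·T)·ν{h ≥ q·T}` pointwise, then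
`y·(M − qT) ≤ (1−y)·qT`. [this work] -/
theorem gate_row_zero (y q : ℝ) (M : ℕ) (ν : ℕ → ℝ) (hy0 : 0 < y) (hy1 : y < 1) (hq0 : 0 < q)
    (hν0 : ∀ h, 0 ≤ ν h) (hν1 : ∑ h ∈ Finset.range (M + 1), ν h = 1)
    (hpos : 0 < q * ∑ h ∈ Finset.range (M + 1), (h : ℝ) * ν h)
    (hTA : y * (M : ℝ) ≤ q * ∑ h ∈ Finset.range (M + 1), (h : ℝ) * ν h) :
    y / (1 - y) * ∑ h ∈ Finset.range (0 + 1), gate ν q h ≤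
      ∑ h ∈ Finset.range (M + 1),
        (if q * (∑ h ∈ Finset.range (M + 1), (h : ℝ) * ν h) - ((0 : ℕ) : ℝ) ≤ (h : ℝ) then gate ν q h else 0) := by
  -- abbreviations (kept as plain hypotheses): `T` the mean, `t = q·T` the target, `H` the tail mass above the target
  obtain ⟨T, hT⟩ : ∃ T : ℝ, T = ∑ h ∈ Finset.range (M + 1), (h : ℝ) * ν h := ⟨_, rfl⟩
  obtain ⟨H, hH⟩ : ∃ H : ℝ, H = ∑ h ∈ Finset.range (M + 1), (if q * T ≤ (h : ℝ) then ν h else 0) := ⟨_, rfl⟩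
  rw [← hT] at hpos hTA ⊢
  have hH0 : 0 ≤ H := by
    rw [hH]; exact Finset.sum_nonneg fun h _ => by split_ifs; exacts [hν0 h, le_rfl]
  -- left side: `u · (q ν 0 + 1 − q)`
  have hL : ∑ h ∈ Finset.range (0 + 1), gate ν q h = q * ν 0 + (1 - q) := by
    simp [gate]
  -- right side: the phantom zero never lies above the (positive) target, so it is `q · H`
  have hR : ∑ h ∈ Finset.range (M + 1), (if q * T - ((0 : ℕ) : ℝ) ≤ (h : ℝ) then gate ν q h else 0) = q * H := by
    rw [hH, Finset.mul_sum]
    refine Finset.sum_congr rfl fun h _ => ?_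
    have e : q * T - ((0 : ℕ) : ℝ) = q * T := by push_cast; ring
    rw [e]
    by_cases hle : q * T ≤ (h : ℝ)
    · rw [if_pos hle, if_pos hle]
      simp only [gate]
      have h0 : h ≠ 0 := by
        rintro rfl
        simp only [Nat.cast_zero] at hle
        linarith
      rw [if_neg h0]; ring
    · rw [if_neg hle, if_neg hle]; ring
  rw [hL, hR]
  -- Markov, pointwise on `h ≤ M`: `h·ν h ≤ qT·(ν h − [h = 0]·ν h) + (M − qT)·[qT ≤ h]·ν h`
  have hMk : T ≤ q * T * (1 - ν 0) + ((M : ℝ) - q * T) * H := by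
    have hpt : ∀ h ∈ Finset.range (M + 1),
        (h : ℝ) * ν h ≤ q * T * (ν h - (if h = 0 then ν h else 0)) + ((M : ℝ) - q * T) * (if q * T ≤ (h : ℝ) then ν h else 0) := by
      intro h hh
      rw [Finset.mem_range] at hh
      have hhM : (h : ℝ) ≤ M := by exact_mod_cast Nat.lt_succ_iff.mp hh
      have hνh := hν0 h
      by_cases h0 : h = 0
      · subst h0
        by_cases hle : q * T ≤ ((0 : ℕ) : ℝ)
        · rw [if_pos rfl, if_pos hle]; simp only [Nat.cast_zero] at hle ⊢; nlinarith
        · rw [if_pos rfl, if_neg hle]; simp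
      · rw [if_neg h0]
        by_cases hle : q * T ≤ (h : ℝ)
        · rw [if_pos hle]; nlinarith
        · rw [if_neg hle]; push Not at hle; nlinarith
    have hs := Finset.sum_le_sum hpt
    rw [Finset.sum_add_distrib, ← Finset.mul_sum, ← Finset.mul_sum, Finset.sum_sub_distrib, hν1,
      Finset.sum_ite_eq' (Finset.range (M + 1)) 0, if_pos (Finset.mem_range.2 (Nat.succ_pos M)), ← hH, ← hT] at hs
    exact hs
  -- TA: `y (M − qT) ≤ (1 − y) qT`
  have hTA' : y * ((M : ℝ) - q * T) ≤ (1 - y) * (q * T) := by nlinarith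
  have hT0 : 0 < T := by
    by_contra h
    have h' : T ≤ 0 := not_lt.mp h
    nlinarith
  have hν00 := hν0 0
  -- combine: (1−y)·qT·H ≥ y·((T − qT) + qT·ν 0), i.e. T·[y(qν0 + 1 − q)] ≤ T·[qH(1−y)], then divide by T
  have key : y * (T - q * T + q * T * ν 0) ≤ (1 - y) * (q * T) * H := by
    have h1 : y * (((M : ℝ) - q * T) * H) ≤ (1 - y) * (q * T) * H := by nlinarith
    nlinarith
  rw [div_mul_eq_mul_div, div_le_iff₀ (by linarith)]
  have key' : T * (y * (q * ν 0 + (1 - q))) ≤ T * (q * H * (1 - y)) := by nlinarith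
  exact le_of_mul_le_mul_left key' hT0

/-- **THE `d = 0` ROW OF THE GATED CONVOLUTION** (the `d = 0` instance of `TLBGateConvClosedHeavy`'s conclusion, for EVERY floor
`0 < y < 1`, without either factor's two-layer bounds): in the node's binder — probability laws `μ₁`, `μ₂` on `{0..M₁}`, `{0..M₂}` with
means `T₁`, `T₂`, top-affordable at `y` for the gate `q` — one has
`y/(1−y) · (gate (lconv μ₁ μ₂) q)(0) ≤ Σ_{h ≤ M₁+M₂, q(T₁+T₂) ≤ h} (gate (lconv μ₁ μ₂) q)(h)` as soon as `0 < q(T₁+T₂)`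
(the row exists only then).  `gate_row_zero` for `ν = lconv μ₁ μ₂` (`sum_lconv`, `sum_mul_lconv`, `lconv_nonneg`). [this work] -/
theorem gate_lconv_row_zero (y q : ℝ) (M₁ M₂ : ℕ) (μ₁ μ₂ : ℕ → ℝ)
    (hy0 : 0 < y) (hy1 : y < 1) (hq0 : 0 < q)
    (n1 : ∀ h, 0 ≤ μ₁ h) (s1 : ∑ h ∈ Finset.range (M₁ + 1), μ₁ h = 1)
    (t1 : y * (M₁ : ℝ) ≤ q * ∑ h ∈ Finset.range (M₁ + 1), (h : ℝ) * μ₁ h)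
    (n2 : ∀ h, 0 ≤ μ₂ h) (s2 : ∑ h ∈ Finset.range (M₂ + 1), μ₂ h = 1)
    (t2 : y * (M₂ : ℝ) ≤ q * ∑ h ∈ Finset.range (M₂ + 1), (h : ℝ) * μ₂ h)
    (hpos : 0 < q * ((∑ h ∈ Finset.range (M₁ + 1), (h : ℝ) * μ₁ h) + ∑ h ∈ Finset.range (M₂ + 1), (h : ℝ) * μ₂ h)) :
    y / (1 - y) * ∑ h ∈ Finset.range (0 + 1), gate (lconv M₁ M₂ μ₁ μ₂) q h ≤
      ∑ h ∈ Finset.range (M₁ + M₂ + 1),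
        (if q * ((∑ h ∈ Finset.range (M₁ + 1), (h : ℝ) * μ₁ h) + ∑ h ∈ Finset.range (M₂ + 1), (h : ℝ) * μ₂ h)
              - ((0 : ℕ) : ℝ) ≤ (h : ℝ)
          then gate (lconv M₁ M₂ μ₁ μ₂) q h else 0) := by
  have hmean := sum_mul_lconv M₁ M₂ μ₁ μ₂ s1 s2
  have key := gate_row_zero y q (M₁ + M₂) (lconv M₁ M₂ μ₁ μ₂) hy0 hy1 hq0 (lconv_nonneg M₁ M₂ μ₁ μ₂ n1 n2)
    (sum_lconv M₁ M₂ μ₁ μ₂ s1 s2) (by rw [hmean]; exact hpos) (by rw [hmean]; push_cast; nlinarith)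
  rw [hmean] at key
  exact key

end LawDec

end Quant

end Summit.CriticalPhenomena.PercolationContinuityZ3.Theorems
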